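import Mathlib.Analysis.InnerProductSpace.Projection.FiniteDimensional
import Mathlib.Analysis.InnerProductSpace.PiL2
import Mathlib.Analysis.Calculus.FDeriv.Mul
import Mathlib.Analysis.Calculus.FDeriv.Add
import Mathlib.Analysis.Calculus.Deriv.Basic
import Mathlib.MeasureTheory.Function.Jacobian
import Mathlib.MeasureTheory.Measure.Lebesgue.EqHaar
import Mathlib.Algebra.Field.Periodic
import HarnessLib

/-!
# General position for sections of a moving `3`-plane

Topic `Literature/Topology/FourManifolds`; infrastructure for the named fact
`Literature.Topology.FourManifolds.exists_isCircleSurgery` (`CircleSurgery.lean`), via the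
triviality of the normal bundle of an embedded circle in an orientable 4-manifold. The normal
bundle of a circle `γ` in a manifold `X ⊆ V = ℝⁿ` (Whitney) is a smooth `1`-periodic family
`t ↦ W t ⊆ V` of `3`-planes, recorded by the smooth family `Q t` of orthogonal projections. This
file produces **two pointwise linearly independent smooth periodic sections** of such a family by
*general position*, with no transversality theory: the constant vector `w`, projected to
`Q t w`, fails to be a good section only if `w` lies in the "bad" set
`⋃ₜ ((W t)ᗮ + ℝ · s t)` (for a given section `s`, possibly zero), and this set is Lebesgue-null —
locally in `t` it is the image of a *proper linear subspace* of `V` under a `C¹` self-map of `V`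
(the easy case of Sard's theorem, Mathlib's
`MeasureTheory.addHaar_image_eq_zero_of_differentiableOn_of_addHaar_eq_zero`, exactly as in the
tree's `Literature.Topology.FourManifolds.exists_forall_smul_ne` of `KnotFraming.lean`), and
`[0, 1]` is compact.

* `Literature.Topology.FourManifolds.exists_mem_orthogonal_sub_proj_eq` — near `t₀` the normal
  spaces `(W t)ᗮ` are parametrised by `(W t₀)ᗮ` through `w ↦ w - Q t w`.
* `Literature.Topology.FourManifolds.exists_local_null_cover` — the local parametrisation of the
  bad set by a proper subspace.
* `Literature.Topology.FourManifolds.exists_forall_proj_ne_smul` — **general position**: for a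
  differentiable `1`-periodic family of rank-`3` orthogonal projections `Q` and a differentiable
  `1`-periodic `s`, some `w` has `Q t w ∉ ℝ · s t` for all `t`.
* `Literature.Topology.FourManifolds.exists_two_sections` — two vectors `w₁`, `w₂` with
  `Q t w₁ ≠ 0` and `Q t w₂ ∉ ℝ · Q t w₁` for all `t`.

Everything here is proved; no named facts are introduced.

## References

* M. W. Hirsch, *Differential Topology*, GTM 33 (1976), Ch. 4 §4, Exercise 2 (bundles over the
  circle), Ch. 3 §1 (measure zero and the easy case of Sard's theorem). [HirschDT1976]
-/

open Set Function Module Metric MeasureTheory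
open scoped RealInnerProductSpace

noncomputable section

namespace Literature.Topology.FourManifolds

variable {V : Type*} [NormedAddCommGroup V] [InnerProductSpace ℝ V] [FiniteDimensional ℝ V]

/-! ### Transfer of normal spaces between nearby planes -/

/-- **Nearby normal spaces are graphs over each other.** If `Q t`, `Q t₀` are the orthogonal
projections onto subspaces `W t`, `W t₀` of the same (finite) dimension and `‖Q t - Q t₀‖ < 1`,
then every vector of `(W t)ᗮ` is `w - Q t w` for some `w ∈ (W t₀)ᗮ` (the map `w ↦ w - Q t w`,
`(W t₀)ᗮ → (W t)ᗮ`, is injective — `‖Q t w‖ = ‖(Q t - Q t₀) w‖ < ‖w‖` — hence onto).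
[folklore] -/
theorem exists_mem_orthogonal_sub_proj_eq {W W₀ : Submodule ℝ V} {Q Q₀ : V →L[ℝ] V}
    (hQ : W.starProjection = Q) (hQ₀ : W₀.starProjection = Q₀)
    (hdim : finrank ℝ W = finrank ℝ W₀) (hclose : ‖Q - Q₀‖ < 1) {y : V} (hy : y ∈ Wᗮ) :
    ∃ w ∈ W₀ᗮ, w - Q w = y := by
  -- the transfer map
  have hmem : ∀ w : V, w - Q w ∈ Wᗮ := fun w => by
    rw [← hQ]
    exact Submodule.sub_starProjection_mem_orthogonal w
  let Φ : W₀ᗮ →ₗ[ℝ] Wᗮ :=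
    { toFun := fun w => ⟨(w : V) - Q w, hmem w⟩
      map_add' := fun a b => by
        ext
        simp only [Submodule.coe_add, map_add]
        abel
      map_smul' := fun c a => by
        ext
        simp only [Submodule.coe_smul, map_smul, RingHom.id_apply, smul_sub] }
  have hinj : Injective Φ := by
    refine (injective_iff_map_eq_zero Φ).2 fun w hw => ?_
    have hw' : (w : V) - Q w = 0 := congrArg Subtype.val hw
    have hQ₀w : Q₀ w = 0 := by
      rw [← hQ₀]
      exact (Submodule.starProjection_apply_eq_zero_iff (K := W₀)).2 w.2
    have hle : ‖(w : V)‖ ≤ ‖Q - Q₀‖ * ‖(w : V)‖ := by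
      calc ‖(w : V)‖ = ‖Q w - Q₀ w‖ := by rw [hQ₀w, sub_zero, ← sub_eq_zero.1 hw']
        _ = ‖(Q - Q₀) w‖ := by rw [sub_apply]
        _ ≤ ‖Q - Q₀‖ * ‖(w : V)‖ := (Q - Q₀).le_opNorm _
    by_contra hne
    have hpos : 0 < ‖(w : V)‖ := norm_pos_iff.2 fun h => hne (Subtype.ext h)
    have : ‖Q - Q₀‖ * ‖(w : V)‖ < 1 * ‖(w : V)‖ := mul_lt_mul_of_pos_right hclose hpos
    rw [one_mul] at this
    exact absurd (hle.trans_lt this) (lt_irrefl _)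
  have hfin : finrank ℝ W₀ᗮ = finrank ℝ Wᗮ := by
    have h1 := Submodule.finrank_add_finrank_orthogonal W₀
    have h2 := Submodule.finrank_add_finrank_orthogonal W
    omega
  have hsurj : Surjective Φ := (LinearMap.injective_iff_surjective_of_finrank_eq_finrank hfin).1 hinj
  obtain ⟨w, hw⟩ := hsurj ⟨y, hy⟩
  exact ⟨w, w.2, congrArg Subtype.val hw⟩

/-! ### The local parametrisation of the bad set by a proper subspace -/

/-- **Local null cover of the bad set.** Let `Q : ℝ → V →L V` be continuous at `t₀` and
differentiable, `Q t` the orthogonal projection onto a `3`-plane `W t`, and `s : ℝ → V`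
differentiable. Then near `t₀` every `z` with `Q t z ∈ ℝ · s t` lies in the image of the proper
subspace `S = (W t₀)ᗮ ⊕ ℝ e ⊕ ℝ e'` (`e, e'` orthonormal in `W t₀`; `dim S = dim V - 1`) under the
differentiable map `f x = (1 - Q ⟪e, x⟫) (x - ⟪e, x⟫ e - ⟪e', x⟫ e') + ⟪e', x⟫ • s ⟪e, x⟫`: indeed
`z = (z - Q t z) + r • s t` with `z - Q t z = w - Q t w`, `w ∈ (W t₀)ᗮ`
(`exists_mem_orthogonal_sub_proj_eq`), and `z = f (w + t e + r e')`. [folklore] -/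
theorem exists_local_null_cover {W : ℝ → Submodule ℝ V} {Q : ℝ → V →L[ℝ] V}
    (hQW : ∀ t, (W t).starProjection = Q t) (hd : ∀ t, finrank ℝ (W t) = 3)
    (hQc : Continuous Q) (hQd : Differentiable ℝ Q) {s : ℝ → V} (hs : Differentiable ℝ s)
    (t₀ : ℝ) :
    ∃ ε > 0, ∃ S : Submodule ℝ V, S ≠ ⊤ ∧ ∃ f : V → V, Differentiable ℝ f ∧
      ∀ t, dist t t₀ < ε → ∀ (z : V) (r : ℝ), Q t z = r • s t → z ∈ f '' S := by
  -- two orthonormal vectors of `W t₀`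
  set b : OrthonormalBasis (Fin (finrank ℝ (W t₀))) ℝ (W t₀) := stdOrthonormalBasis ℝ (W t₀)
    with hb
  have h3 : finrank ℝ (W t₀) = 3 := hd t₀
  set i₀ : Fin (finrank ℝ (W t₀)) := ⟨0, by omega⟩
  set i₁ : Fin (finrank ℝ (W t₀)) := ⟨1, by omega⟩
  have hi : i₀ ≠ i₁ := by simp [i₀, i₁, Fin.ext_iff]
  set e : V := (b i₀ : V) with he
  set e' : V := (b i₁ : V) with he'
  have he_mem : e ∈ W t₀ := (b i₀).2
  have he'_mem : e' ∈ W t₀ := (b i₁).2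
  have hee : ⟪e, e⟫ = 1 := by
    rw [he, ← Submodule.coe_inner, real_inner_self_eq_norm_sq, b.orthonormal.1 i₀, one_pow]
  have he'e' : ⟪e', e'⟫ = 1 := by
    rw [he', ← Submodule.coe_inner, real_inner_self_eq_norm_sq, b.orthonormal.1 i₁, one_pow]
  have hee' : ⟪e, e'⟫ = 0 := by
    rw [he, he', ← Submodule.coe_inner]
    exact b.orthonormal.2 hi
  have he'e : ⟪e', e⟫ = 0 := by rw [real_inner_comm, hee']
  -- the proper subspace
  set S : Submodule ℝ V := (W t₀)ᗮ ⊔ (ℝ ∙ e) ⊔ (ℝ ∙ e') with hS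
  have hS_ne : S ≠ ⊤ := by
    intro htop
    have hn : finrank ℝ (W t₀) + finrank ℝ (W t₀)ᗮ = finrank ℝ V :=
      Submodule.finrank_add_finrank_orthogonal (W t₀)
    have h1 : finrank ℝ S ≤ finrank ℝ (W t₀)ᗮ + 1 + 1 := by
      calc finrank ℝ S ≤ finrank ℝ ↥((W t₀)ᗮ ⊔ (ℝ ∙ e)) + finrank ℝ (ℝ ∙ e') :=
            Submodule.finrank_add_le_finrank_add_finrank _ _
        _ ≤ (finrank ℝ (W t₀)ᗮ + finrank ℝ (ℝ ∙ e)) + finrank ℝ (ℝ ∙ e') := by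
            gcongr
            exact Submodule.finrank_add_le_finrank_add_finrank _ _
        _ ≤ finrank ℝ (W t₀)ᗮ + 1 + 1 := by
            gcongr
            · exact (finrank_span_le_card ({e} : Set V)).trans (by simp)
            · exact (finrank_span_le_card ({e'} : Set V)).trans (by simp)
    have h2 : finrank ℝ S = finrank ℝ V := by rw [htop, finrank_top]
    omega
  -- the parametrisation
  set f : V → V := fun x =>
    (x - ⟪e, x⟫ • e - ⟪e', x⟫ • e') - Q ⟪e, x⟫ (x - ⟪e, x⟫ • e - ⟪e', x⟫ • e') +
      ⟪e', x⟫ • s ⟪e, x⟫ with hf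
  have hℓ : Differentiable ℝ fun x : V => ⟪e, x⟫ := (innerSL ℝ e).differentiable
  have hℓ' : Differentiable ℝ fun x : V => ⟪e', x⟫ := (innerSL ℝ e').differentiable
  have hlin : Differentiable ℝ fun x : V => x - ⟪e, x⟫ • e - ⟪e', x⟫ • e' :=
    (differentiable_id.sub (hℓ.smul_const e)).sub (hℓ'.smul_const e')
  have hf_diff : Differentiable ℝ f := by
    refine (hlin.sub ?_).add ((hℓ'.smul (hs.comp hℓ)))
    exact (hQd.comp hℓ).clm_apply hlin
  -- continuity of `Q` at `t₀` gives the neighbourhood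
  obtain ⟨ε, hε, hball⟩ : ∃ ε > 0, ∀ t, dist t t₀ < ε → ‖Q t - Q t₀‖ < 1 := by
    obtain ⟨ε, hε, h⟩ := Metric.continuousAt_iff.1 (hQc.continuousAt (x := t₀)) 1 one_pos
    exact ⟨ε, hε, fun t ht => by simpa [dist_eq_norm] using h ht⟩
  refine ⟨ε, hε, S, hS_ne, f, hf_diff, fun t ht z r hz => ?_⟩
  -- decompose `z`
  have hy : z - Q t z ∈ (W t)ᗮ := by
    rw [← hQW t]
    exact Submodule.sub_starProjection_mem_orthogonal z
  obtain ⟨w, hw, hwy⟩ :=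
    exists_mem_orthogonal_sub_proj_eq (hQW t) (hQW t₀) (by rw [hd, hd]) (hball t ht) hy
  refine ⟨w + t • e + r • e', ?_, ?_⟩
  · -- membership in `S`
    refine Submodule.add_mem _ (Submodule.add_mem _ ?_ ?_) ?_
    · exact Submodule.mem_sup_left (Submodule.mem_sup_left hw)
    · exact Submodule.mem_sup_left (Submodule.mem_sup_right (Submodule.smul_mem _ _
        (Submodule.mem_span_singleton_self e)))
    · exact Submodule.mem_sup_right (Submodule.smul_mem _ _ (Submodule.mem_span_singleton_self e'))
  · -- the value of `f`
    have hwe : ⟪e, w⟫ = 0 := Submodule.inner_right_of_mem_orthogonal he_mem hw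
    have hwe' : ⟪e', w⟫ = 0 := Submodule.inner_right_of_mem_orthogonal he'_mem hw
    have h1 : ⟪e, w + t • e + r • e'⟫ = t := by
      rw [inner_add_right, inner_add_right, inner_smul_right, inner_smul_right, hwe, hee, hee']
      ring
    have h2 : ⟪e', w + t • e + r • e'⟫ = r := by
      rw [inner_add_right, inner_add_right, inner_smul_right, inner_smul_right, hwe', he'e, he'e']
      ring
    have h3' : w + t • e + r • e' - t • e - r • e' = w := by abel
    simp only [hf, h1, h2, h3']
    rw [hwy, ← hz]
    abel

/-! ### General position -/

/-- **General position for a moving `3`-plane.** Let `Q : ℝ → V →L V` be a differentiable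
`1`-periodic family of orthogonal projections onto `3`-planes `W t ⊆ V` and `s : ℝ → V` a
differentiable `1`-periodic map. Then some `w : V` satisfies `Q t w ∉ ℝ · s t` for every `t`:
the bad set `⋃ₜ {z | Q t z ∈ ℝ · s t}` is covered, by compactness of `[0, 1]` and periodicity, by
finitely many images of proper subspaces under differentiable maps
(`exists_local_null_cover`), hence is Lebesgue-null (the easy case of Sard's theorem), so it is
not all of `V`. For `s = 0` this is a nowhere vanishing section `t ↦ Q t w` of `W`
(Hirsch, *Differential Topology* (1976), Ch. 4 §4, Exercise 2; Ch. 3 §1). [folklore] -/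
theorem exists_forall_proj_ne_smul {W : ℝ → Submodule ℝ V} {Q : ℝ → V →L[ℝ] V}
    (hQW : ∀ t, (W t).starProjection = Q t) (hd : ∀ t, finrank ℝ (W t) = 3)
    (hQ : Differentiable ℝ Q) (hQper : Periodic Q 1) {s : ℝ → V} (hs : Differentiable ℝ s)
    (hsper : Periodic s 1) : ∃ w : V, ∀ (t : ℝ) (r : ℝ), Q t w ≠ r • s t := by
  classical
  borelize V
  set μ : Measure V := Measure.addHaar
  -- local covers and a finite subcover of `[0, 1]`
  have hloc := fun t₀ : ℝ => exists_local_null_cover hQW hd hQ.continuous hQ hs t₀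
  choose ε hε S hS f hf hcov using hloc
  obtain ⟨T, -, hT⟩ := (isCompact_Icc (a := (0 : ℝ)) (b := 1)).elim_nhds_subcover
    (fun t => ball t (ε t)) fun t _ => ball_mem_nhds t (hε t)
  -- the bad set and its nullity
  set bad : Set V := {w | ∃ (t : ℝ) (r : ℝ), Q t w = r • s t} with hbad
  have hsub : bad ⊆ ⋃ t ∈ T, f t '' (S t : Set V) := by
    rintro w ⟨t, r, htr⟩
    have hper : Periodic (fun t => (Q t, s t)) 1 := fun x => by
      simp only [hQper x, hsper x]
    obtain ⟨t', ht', heq⟩ := hper.exists_mem_Ico₀ one_pos t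
    simp only [Prod.mk.injEq] at heq
    have ht'T : t' ∈ ⋃ x ∈ T, ball x (ε x) := hT ⟨ht'.1, ht'.2.le⟩
    simp only [mem_iUnion] at ht'T
    obtain ⟨t₁, ht₁, hball⟩ := ht'T
    simp only [mem_iUnion]
    refine ⟨t₁, ht₁, hcov t₁ t' hball w r ?_⟩
    rw [← heq.1, ← heq.2, htr]
  have hnull : μ bad = 0 := by
    refine measure_mono_null hsub ((measure_biUnion_null_iff T.countable_toSet).2 fun t _ => ?_)
    exact addHaar_image_eq_zero_of_differentiableOn_of_addHaar_eq_zero μ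
      (hf t).differentiableOn (Measure.addHaar_submodule μ (S t) (hS t))
  -- a point off the bad set
  by_contra hcon
  push Not at hcon
  have huniv : bad = univ := eq_univ_of_forall fun w => by
    obtain ⟨t, r, h⟩ := hcon w
    exact ⟨t, r, h⟩
  rw [huniv] at hnull
  exact isOpen_univ.measure_ne_zero μ univ_nonempty hnull

/-- **Two independent sections of a moving `3`-plane.** In the situation of
`exists_forall_proj_ne_smul` there are `w₁ w₂ : V` with `Q t w₁ ≠ 0` and `Q t w₂ ∉ ℝ · Q t w₁`
for every `t`; thus `t ↦ Q t w₁`, `t ↦ Q t w₂` are two pointwise linearly independent smooth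
`1`-periodic sections of `W` (apply general position to `s = 0`, then to `s = Q · w₁`)
(Hirsch, *Differential Topology* (1976), Ch. 4 §4, Exercise 2). [folklore] -/
theorem exists_two_sections {W : ℝ → Submodule ℝ V} {Q : ℝ → V →L[ℝ] V}
    (hQW : ∀ t, (W t).starProjection = Q t) (hd : ∀ t, finrank ℝ (W t) = 3)
    (hQ : Differentiable ℝ Q) (hQper : Periodic Q 1) :
    ∃ w₁ w₂ : V, (∀ t, Q t w₁ ≠ 0) ∧ ∀ (t : ℝ) (r : ℝ), Q t w₂ ≠ r • Q t w₁ := by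
  obtain ⟨w₁, hw₁⟩ := exists_forall_proj_ne_smul hQW hd hQ hQper (s := fun _ => (0 : V))
    (differentiable_const _) (fun _ => rfl)
  have h1 : ∀ t, Q t w₁ ≠ 0 := fun t h => hw₁ t 0 (by rw [h, zero_smul])
  have hs : Differentiable ℝ fun t => Q t w₁ := hQ.clm_apply (differentiable_const _)
  have hsper : Periodic (fun t => Q t w₁) 1 := fun t => by simp only [hQper t]
  obtain ⟨w₂, hw₂⟩ := exists_forall_proj_ne_smul hQW hd hQ hQper hs hsper
  exact ⟨w₁, w₂, h1, hw₂⟩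

end Literature.Topology.FourManifolds
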